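import Mathlib
import Summits.PneNP.PneNP.Theorems.SfmBlPipelineAux
import Summits.PneNP.PneNP.Theorems.Sd2BlSpotBudget

/-!
# The explicit spot package for `ℓ` legs per output and density factor `K` — line «sfm-bl» made
# parametric (cell pnp-ideate, ROUND-18 item K1'' `SignDeg2Signing.SignDeg2SigningFP`, stage S2)

FRONTIER (range avoidance for sign-degree-≤2 local maps at linear stretch; restricted-model algorithmic
rung); nothing here bears on P vs NP.

`SfmBl.spot_package_explicit` (the per-spot conclusions of PROOF-SFM-BL Prop. 9 + Lemma 10, explicit-`ê`
form) has `≤ 3` legs per output and the density factor `60` (hence the spot term `#E/30`) baked in.  The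
sign-degree-2 engine needs `ℓ = 2W` legs per output and a spot term `2·#E/K` with `K` of order `ℓ` (the
target is a `1/W` fraction of the trivial bound).  `spot_package_explicit_ell` is that twin:

* legs `e : E` inside the spot (`src e ∈ V₁`, `dst e ∈ V₂`), `≤ ℓ` legs per output, leg-degrees `≤ Lₙ`;
* BAD threshold `γ` (a pair is bad under `T` iff it is a connected pair inside the spot with
  `γ√(|W₁||W₂|) < |disc_T|`), an auxiliary `γ′` with `144·Lₙ·ln Lₙ ≤ γ′²` and `γ′²·ℓ ≤ 3γ²` for the numerics;
* DENSITY `K·γ·√(|V₁||V₂|) < #E`, `0 < K`;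
* conclusions: every `±1` cut value is `< 2·#E/K + ê(T)`, and `Σ_T ê(T) ≤ 2^m·4(|V₁|+|V₂|)·Lₙ⁻¹⁰`.

Proof = the landed Prop. 9 (`SfmBl.spot_cut_le`, any `γ`), `SfmBl.good_of_disjoint_bad`,
`SfmBl.card_meeting_bad_le_hatE`, the `ℓ`-Lemma 10 `Sd2Bl.sum_hatE_le_ell`, and the landed counting /
series `SfmBl.card_spotPairs_le`, `SfmBl.hatE_weight_sum_le` verbatim.
-/

set_option linter.dupNamespace false -- `Summit.PneNP.PneNP.…`: summit = sub-problem name (D-0017 single-conjunct layout)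

namespace Summit.PneNP.PneNP.Theorems.Sd2Bl

open Matrix Finset BigOperators
open Summit.PneNP.PneNP.Theorems.CandCutNorm Summit.PneNP.PneNP.Theorems.SfmBl

/-- **SPOT PACKAGE, EXPLICIT FORM, `ℓ` legs per output, density factor `K`** (see the module docstring). -/
theorem spot_package_explicit_ell {α β E : Type} [Fintype α] [Fintype β] [DecidableEq α] [DecidableEq β]
    [Fintype E] {m : ℕ} (src : E → α) (dst : E → β) (out : E → Fin m)
    (V₁ : Finset α) (V₂ : Finset β) (hE : ∀ e, src e ∈ V₁ ∧ dst e ∈ V₂)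
    {ℓ : ℕ} (hℓ : 0 < ℓ) (hout : ∀ j : Fin m, (Finset.univ.filter fun e => out e = j).card ≤ ℓ)
    {Lₙ : ℕ} (hLₙ : 0 < Lₙ) (hdeg₁ : ∀ i, (Finset.univ.filter fun e => src e = i).card ≤ Lₙ)
    (hdeg₂ : ∀ k, (Finset.univ.filter fun e => dst e = k).card ≤ Lₙ)
    (hLₙ2 : 2 ≤ (Lₙ : ℝ)) {γ γ' : ℝ} (hγ : 0 ≤ γ) (hγ'L : 144 * (Lₙ : ℝ) * Real.log Lₙ ≤ γ' ^ 2)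
    (hγγ' : γ' ^ 2 * ℓ ≤ 3 * γ ^ 2)
    {K : ℝ} (hK : 0 < K) (hdense : K * γ * Real.sqrt ((V₁.card : ℝ) * (V₂.card : ℝ)) < Fintype.card E)
    (M : (Fin m → Bool) → Matrix α β ℝ)
    (hM : ∀ T i k, M T i k = ∑ e ∈ Finset.univ.filter (fun e => src e = i ∧ dst e = k),
      ((boolSign (T (out e)) : ℤ) : ℝ))
    (𝒲 : Finset (Finset α × Finset β))
    (h𝒲 : ∀ W, W ∈ 𝒲 ↔ W.1 ⊆ V₁ ∧ W.2 ⊆ V₂ ∧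
      IsConnectedPair (fun i k => ∃ e, src e = i ∧ dst e = k) W.1 W.2)
    (bad : (Fin m → Bool) → Finset (Finset α × Finset β))
    (hbad : ∀ T W, W ∈ bad T ↔ W ∈ 𝒲 ∧
      γ * Real.sqrt ((W.1.card : ℝ) * (W.2.card : ℝ)) < |∑ i ∈ W.1, ∑ k ∈ W.2, M T i k|) :
    (∀ (T : Fin m → Bool) (σ : α → ℝ) (φ : β → ℝ), (∀ i, σ i = 1 ∨ σ i = -1) →
        (∀ k, φ k = 1 ∨ φ k = -1) → σ ⬝ᵥ (M T *ᵥ φ) < 2 * (Fintype.card E : ℝ) / K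
          + ∑ W ∈ bad T, ((Finset.univ.filter fun e => src e ∈ W.1 ∨ dst e ∈ W.2).card : ℝ)) ∧
    (∑ T, ∑ W ∈ bad T, ((Finset.univ.filter fun e => src e ∈ W.1 ∨ dst e ∈ W.2).card : ℝ)
        ≤ 2 ^ m * (4 * ((V₁.card : ℝ) + V₂.card) * ((Lₙ : ℝ) ^ 10)⁻¹)) := by
  classical
  obtain ⟨Es, hEs⟩ : ∃ Es : α → β → Prop, Es = fun i k => ∃ e, src e = i ∧ dst e = k := ⟨_, rfl⟩
  have hG : ∀ e, (bipGraph Es).Adj (Sum.inl (src e)) (Sum.inr (dst e)) := fun e =>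
    (bipGraph_adj_inl_inr Es _ _).2 (by rw [hEs]; exact ⟨e, rfl, rfl⟩)
  have hsub : ∀ T, bad T ⊆ 𝒲 := fun T W hW => ((hbad T W).1 hW).1
  have hbad' : ∀ T W, W ∈ bad T →
      γ * Real.sqrt ((W.1.card : ℝ) * (W.2.card : ℝ)) < |∑ i ∈ W.1, ∑ k ∈ W.2, M T i k| :=
    fun T W hW => ((hbad T W).1 hW).2
  refine ⟨?_, ?_⟩
  · ----------------------------------------------------------------
    -- Prop. 9 with `B = ⋃ bad`, density factor `K`
    ----------------------------------------------------------------
    intro T σ φ hσ hφ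
    have hs : ∀ e : E, |((boolSign (T (out e)) : ℤ) : ℝ)| ≤ 1 := fun e => by
      rcases boolSign_eq_one_or (T (out e)) with h | h <;> simp [h]
    suffices hbadT : ∀ (W₁ : Finset α) (W₂ : Finset β),
        ((bipGraph Es).induce {x | Sum.elim (fun i => i ∈ W₁) (fun j => j ∈ W₂) x}).Connected →
        γ * Real.sqrt ((W₁.card : ℝ) * (W₂.card : ℝ)) < |∑ i ∈ W₁, ∑ k ∈ W₂, M T i k| →
        (W₁, W₂) ∈ bad T by
      have h1 := spot_cut_le src dst V₁ V₂ hE (fun e => ((boolSign (T (out e)) : ℤ) : ℝ)) hs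
        (M T) (hM T) (bipGraph Es) hG hγ ((bad T).biUnion Prod.fst) ((bad T).biUnion Prod.snd)
        (fun W₁ W₂ hd₁ hd₂ hconn => good_of_disjoint_bad (bipGraph Es) (M T) (bad T) hbadT W₁ W₂ hd₁ hd₂ hconn)
        σ φ hσ hφ
      have h2 : ((Finset.univ.filter fun e =>
            src e ∈ (bad T).biUnion Prod.fst ∨ dst e ∈ (bad T).biUnion Prod.snd).card : ℝ)
          ≤ ∑ W ∈ bad T, ((Finset.univ.filter fun e => src e ∈ W.1 ∨ dst e ∈ W.2).card : ℝ) := by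
        exact_mod_cast card_meeting_bad_le_hatE src dst (bad T)
      -- density: `2γ√(|V₁||V₂|) < 2·#E/K`
      have h3 : 2 * γ * Real.sqrt ((V₁.card : ℝ) * (V₂.card : ℝ)) < 2 * (Fintype.card E : ℝ) / K := by
        rw [lt_div_iff₀ hK]
        have := mul_lt_mul_of_pos_left hdense (by norm_num : (0 : ℝ) < 2)
        linarith
      linarith
    intro W₁ W₂ hconn hdisc
    have hne₁ : W₁.Nonempty := by
      rw [Finset.nonempty_iff_ne_empty]; rintro rfl
      simp only [Finset.sum_empty, abs_zero, Finset.card_empty, Nat.cast_zero, zero_mul,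
        Real.sqrt_zero, mul_zero, lt_self_iff_false] at hdisc
    have hne₂ : W₂.Nonempty := by
      rw [Finset.nonempty_iff_ne_empty]; rintro rfl
      simp only [Finset.sum_empty, Finset.sum_const_zero, abs_zero, Finset.card_empty, Nat.cast_zero,
        mul_zero, Real.sqrt_zero, lt_self_iff_false] at hdisc
    obtain ⟨i₀, hi₀⟩ := hne₁
    obtain ⟨k₀, hk₀⟩ := hne₂
    have hX : ∀ x, x ∈ ({x | Sum.elim (fun i => i ∈ W₁) (fun j => j ∈ W₂) x} : Set (α ⊕ β)) →
        Sum.elim (fun i => i ∈ V₁) (fun j => j ∈ V₂) x := by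
      intro x hx
      obtain ⟨y, hy, hxy⟩ : ∃ y, y ∈ ({x | Sum.elim (fun i => i ∈ W₁) (fun j => j ∈ W₂) x} :
          Set (α ⊕ β)) ∧ x ≠ y := by
        by_cases h : x = Sum.inl i₀
        · exact ⟨Sum.inr k₀, by simpa using hk₀, by rw [h]; exact Sum.inl_ne_inr⟩
        · exact ⟨Sum.inl i₀, by simpa using hi₀, h⟩
      obtain ⟨z, _, hxz⟩ := exists_adj_of_connected_induce (bipGraph Es) _ hconn hx hy hxy
      cases x with
      | inl i =>
        cases z with
        | inl i' => exact absurd hxz (bipGraph_not_adj_inl_inl _ _ _)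
        | inr k =>
          have h' := (bipGraph_adj_inl_inr Es _ _).1 hxz
          rw [hEs] at h'
          obtain ⟨e, he1, _⟩ := h'
          simp only [Sum.elim_inl]; rw [← he1]; exact (hE e).1
      | inr k =>
        cases z with
        | inr k' => exact absurd hxz (bipGraph_not_adj_inr_inr _ _ _)
        | inl i =>
          have h' := (bipGraph_adj_inr_inl Es _ _).1 hxz
          rw [hEs] at h'
          obtain ⟨e, _, he2⟩ := h'
          simp only [Sum.elim_inr]; rw [← he2]; exact (hE e).2
    have hW₁ : W₁ ⊆ V₁ := fun i hi => by simpa using hX (Sum.inl i) (by simpa using hi)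
    have hW₂ : W₂ ⊆ V₂ := fun k hk => by simpa using hX (Sum.inr k) (by simpa using hk)
    have hconn' : IsConnectedPair Es W₁ W₂ := by
      unfold IsConnectedPair
      rw [coe_disjSum_eq_setOf]; exact hconn
    rw [hbad, h𝒲]
    refine ⟨⟨hW₁, hW₂, ?_⟩, hdisc⟩
    rw [hEs] at hconn'; exact hconn'
  · ----------------------------------------------------------------
    -- Lemma 10 (ℓ legs) + counting + numerics (landed, verbatim in `γ′`)
    ----------------------------------------------------------------
    have h1 := sum_hatE_le_ell src dst out M hM hℓ hout hLₙ hdeg₁ hdeg₂ hγ hγγ' bad 𝒲 hsub hbad'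
    have h2 : ∑ W ∈ 𝒲, ((Finset.univ.filter fun e => src e ∈ W.1 ∨ dst e ∈ W.2).card : ℝ)
          * Real.exp (-(γ' ^ 2 * ((W.1.card : ℝ) + W.2.card) / (12 * Lₙ)))
        ≤ ∑ W ∈ 𝒲, ((Lₙ : ℝ) * ((W.1.card : ℝ) + W.2.card))
          * Real.exp (-(γ' ^ 2 * ((W.1.card : ℝ) + W.2.card) / (12 * Lₙ))) := by
      refine Finset.sum_le_sum fun W _ => mul_le_mul_of_nonneg_right ?_ (Real.exp_pos _).le
      exact_mod_cast card_meeting_le src dst hdeg₁ hdeg₂ W.1 W.2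
    have hV0 : (0 : ℝ) ≤ (V₁.card : ℝ) + V₂.card := add_nonneg (Nat.cast_nonneg _) (Nat.cast_nonneg _)
    have hcount : ∀ k, ((𝒲.filter fun W => W.1.card + W.2.card = k).card : ℝ)
        ≤ ((V₁.card : ℝ) + V₂.card) * (Lₙ : ℝ) ^ (2 * (k - 1)) := by
      intro k
      refine card_spotPairs_le src dst V₁ V₂ hdeg₁ hdeg₂ k _ fun W hW => ?_
      rw [Finset.mem_filter, h𝒲] at hW
      exact ⟨hW.1.1, hW.1.2.1, hW.1.2.2, hW.2⟩
    have h3 := hatE_weight_sum_le 𝒲 hV0 hLₙ2 hγ'L hcount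
    have hLₙ0 : (0 : ℝ) < Lₙ := by exact_mod_cast hLₙ
    have h2m : (0 : ℝ) ≤ 2 * 2 ^ m := by
      have : (0 : ℝ) ≤ 2 ^ m := pow_nonneg (by norm_num) m
      linarith
    calc ∑ T, ∑ W ∈ bad T, ((Finset.univ.filter fun e => src e ∈ W.1 ∨ dst e ∈ W.2).card : ℝ)
        ≤ 2 * 2 ^ m * ∑ W ∈ 𝒲, ((Finset.univ.filter fun e => src e ∈ W.1 ∨ dst e ∈ W.2).card : ℝ)
            * Real.exp (-(γ' ^ 2 * ((W.1.card : ℝ) + W.2.card) / (12 * Lₙ))) := h1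
      _ ≤ 2 * 2 ^ m * (((V₁.card : ℝ) + V₂.card) * ((Lₙ : ℝ) * (2 * ((Lₙ : ℝ) ^ 11)⁻¹))) :=
          mul_le_mul_of_nonneg_left (h2.trans h3) h2m
      _ = 2 ^ m * (4 * ((V₁.card : ℝ) + V₂.card) * ((Lₙ : ℝ) * ((Lₙ : ℝ) ^ 11)⁻¹)) := by ring
      _ = 2 ^ m * (4 * ((V₁.card : ℝ) + V₂.card) * ((Lₙ : ℝ) ^ 10)⁻¹) := by
          have : (Lₙ : ℝ) * ((Lₙ : ℝ) ^ 11)⁻¹ = ((Lₙ : ℝ) ^ 10)⁻¹ := by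
            field_simp
          rw [this]

end Summit.PneNP.PneNP.Theorems.Sd2Bl
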